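import Summits.PneNP.PneNP.Theses.ForcedSplits
import Summits.PneNP.PneNP.Theorems.ForcedSplitsRunInvariants
import Summits.PneNP.PneNP.Theorems.ExpanderLinearGeneratorsRandomKCNF

/-!
# Route ForcedSplits — `AccountingLemma` (stmt-PneNP-8178)

`Pr[root unsatisfiable ∧ g(root) = 1 ∧ path unclean] ≤ E[number of (E)-violations]`, for every `n` and every labelling
`g` vanishing on formulas with the empty clause. Pointwise: on the support of the flow the root is a 3-CNF over the
variables `< n`; an unsatisfiable accepted root whose path has NO violation is clean (`ForcedSplitsRunInvariants`:
the label sequence starts at `1`, ends at `0` because the final node contains the empty clause, is monotone by (E), and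
its unique drop is at a free step with sibling labelled `1`), so the indicator of the event is at most the number of
violations; summing against the flow's mass gives the inequality of outer measure and `tsum`.
-/

set_option linter.dupNamespace false -- `Summit.PneNP.PneNP.…`: summit = sub-problem name (D-0017 single-conjunct layout)

namespace Summit.PneNP.PneNP.Theorems

open Literature.Computability.Complexity

/-- **The restriction keeps only literals of the input, off the restricted variable.** [folklore] -/
theorem forcedSplits_restrict_literals (ψ : CNF ℕ) (v : ℕ) (b : Bool) :
    ∀ c ∈ (ψ.filter fun c => decide ((v, b) ∉ c)).map (fun c => c.filter fun l => decide (l ≠ (v, !b))),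
      ∀ l ∈ c, (∃ c' ∈ ψ, l ∈ c') ∧ l.1 ≠ v := by
  intro c hc l hl
  rw [List.mem_map] at hc
  obtain ⟨c₀, hc₀, rfl⟩ := hc
  rw [List.mem_filter] at hc₀ hl
  obtain ⟨hc₀, hvb⟩ := hc₀
  obtain ⟨hl, hne⟩ := hl
  simp only [decide_eq_true_eq] at hvb hne
  refine ⟨⟨c₀, hc₀, hl⟩, fun hv => ?_⟩
  rcases l with ⟨w, b'⟩
  simp only at hv
  subst hv
  rcases Bool.eq_or_eq_not b' b with rfl | rfl
  · exact hvb hl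
  · exact hne rfl

/-- **Satisfiability lifts along a restriction** (`σ ↦ σ[v := b]`). [folklore] -/
theorem forcedSplits_restrict_satisfiable (ψ : CNF ℕ) (v : ℕ) (b : Bool)
    (h : CNF.Satisfiable ((ψ.filter fun c => decide ((v, b) ∉ c)).map (fun c => c.filter fun l => decide (l ≠ (v, !b))))) :
    ψ.Satisfiable := by
  classical
  obtain ⟨σ, hσ⟩ := h
  refine ⟨Function.update σ v b, ?_⟩
  rw [CNF.eval, List.all_eq_true] at hσ ⊢
  intro c₀ hc₀
  rw [List.any_eq_true]
  by_cases hvb : (v, b) ∈ c₀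
  · exact ⟨(v, b), hvb, by simp [Literal.eval]⟩
  · have hc : (c₀.filter fun l => decide (l ≠ (v, !b))) ∈
        (ψ.filter fun c => decide ((v, b) ∉ c)).map (fun c => c.filter fun l => decide (l ≠ (v, !b))) :=
      List.mem_map.2 ⟨c₀, List.mem_filter.2 ⟨hc₀, by simpa using hvb⟩, rfl⟩
    obtain ⟨l, hl, hlt⟩ := List.any_eq_true.1 (hσ _ hc)
    rw [List.mem_filter] at hl
    obtain ⟨hl, hne⟩ := hl
    simp only [decide_eq_true_eq] at hne
    have hw : l.1 ≠ v := by
      intro hw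
      rcases l with ⟨w, b'⟩
      simp only at hw
      subst hw
      rcases Bool.eq_or_eq_not b' b with rfl | rfl
      · exact hvb hl
      · exact hne rfl
    refine ⟨l, hl, ?_⟩
    rw [Literal.eval, Function.update_of_ne hw]
    exact hlt

/-- **A forced sibling contains the empty clause**: restricting at the negation of a unit clause empties it. [folklore] -/
theorem forcedSplits_restrict_unit (ψ : CNF ℕ) (v : ℕ) (b : Bool) (h : [(v, b)] ∈ ψ) :
    ([] : Clause ℕ) ∈ (ψ.filter fun c => decide ((v, !b) ∉ c)).map (fun c => c.filter fun l => decide (l ≠ (v, !!b))) := by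
  refine List.mem_map.2 ⟨[(v, b)], List.mem_filter.2 ⟨h, ?_⟩, ?_⟩
  · simp
  · simp

/-- **`AccountingLemma` (stmt-PneNP-8178).** [folklore] -/
theorem forcedSplits_accountingLemma_proof : Summit.PneNP.PneNP.Theses.ForcedSplits.AccountingLemma := by
  classical
  unfold Summit.PneNP.PneNP.Theses.ForcedSplits.AccountingLemma
  intro restrict step run J nviol clean n g hg0
  -- one step of the flow
  have hfix : ∀ (π : Equiv.Perm (Fin n)) (β : Fin n → Bool) (s : CNF ℕ × List (CNF ℕ × ℕ × Bool × Bool)),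
      ([] : Clause ℕ) ∈ s.1 → step n π β s = s := by
    intro π β s h0
    simp only [step, h0, if_true]
  have hcases : ∀ (π : Equiv.Perm (Fin n)) (β : Fin n → Bool) (s : CNF ℕ × List (CNF ℕ × ℕ × Bool × Bool)),
      ([] : Clause ℕ) ∉ s.1 →
        (step n π β s = s ∧ ∀ i : Fin n, ((π i : Fin n) : ℕ) ∈ s.2.map fun r => r.2.1) ∨
        ∃ (v : ℕ) (b f : Bool), step n π β s = (restrict s.1 v b, (s.1, v, b, f) :: s.2) ∧
          (f = true → [(v, b)] ∈ s.1) ∧ ((∃ c ∈ s.1, ∃ l ∈ c, l.1 = v) ∨ (v < n ∧ v ∉ s.2.map fun r => r.2.1)) := by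
    intro π β s h0
    rcases hfu : s.1.find? (fun c => c.length == 1) with _ | c
    · rcases hfi : (List.finRange n).find? (fun i => decide (((π i : Fin n) : ℕ) ∉ s.2.map fun r => r.2.1)) with _ | i
      · left
        refine ⟨by simp only [step, h0, if_false, hfu, hfi], fun i => ?_⟩
        have h := List.find?_eq_none.1 hfi i (List.mem_finRange i)
        simpa only [decide_eq_true_eq, not_not] using h
      · right
        refine ⟨π i, β (π i), false, by simp only [step, h0, if_false, hfu, hfi], fun h => Bool.noConfusion h, Or.inr ⟨(π i).isLt, ?_⟩⟩
        have h := List.find?_some hfi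
        exact of_decide_eq_true h
    · right
      have hlen : c.length = 1 := by simpa using List.find?_some hfu
      obtain ⟨l, rfl⟩ := List.length_eq_one_iff.1 hlen
      have hmem : [l] ∈ s.1 := List.mem_of_find?_eq_some hfu
      refine ⟨l.1, l.2, true, by simp only [step, h0, if_false, hfu, List.head?_cons], fun _ => hmem, Or.inl ⟨[l], hmem, l, List.mem_singleton_self l, rfl⟩⟩
  have hstep : ∀ (π : Equiv.Perm (Fin n)) (β : Fin n → Bool) (s : CNF ℕ × List (CNF ℕ × ℕ × Bool × Bool)),
      step n π β s = s ∨ ∃ (v : ℕ) (b f : Bool), step n π β s = (restrict s.1 v b, (s.1, v, b, f) :: s.2) ∧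
        (f = true → [(v, b)] ∈ s.1) ∧ ((∃ c ∈ s.1, ∃ l ∈ c, l.1 = v) ∨ (v < n ∧ v ∉ s.2.map fun r => r.2.1)) := by
    intro π β s
    by_cases h0 : ([] : Clause ℕ) ∈ s.1
    · exact Or.inl (hfix π β s h0)
    · rcases hcases π β s h0 with ⟨h, -⟩ | h
      · exact Or.inl h
      · exact Or.inr h
  have hhalt : ∀ (π : Equiv.Perm (Fin n)) (β : Fin n → Bool) (s : CNF ℕ × List (CNF ℕ × ℕ × Bool × Bool)),
      step n π β s = s → ([] : Clause ℕ) ∉ s.1 → ∀ v, v < n → v ∈ s.2.map fun r => r.2.1 := by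
    intro π β s hs h0 v hv
    rcases hcases π β s h0 with ⟨-, h⟩ | ⟨w, b, f, hF, -, -⟩
    · have h' := h (π.symm ⟨v, hv⟩)
      simpa using h'
    · exfalso
      have := congrArg (fun p => p.2.length) (hs.symm.trans hF)
      simp at this
  have hR : ∀ (ψ : CNF ℕ) (v : ℕ) (b : Bool), ∀ c ∈ restrict ψ v b, ∀ l ∈ c, (∃ c' ∈ ψ, l ∈ c') ∧ l.1 ≠ v :=
    fun ψ v b => forcedSplits_restrict_literals ψ v b
  have hsat : ∀ (ψ : CNF ℕ) (v : ℕ) (b : Bool), (restrict ψ v b).Satisfiable → ψ.Satisfiable :=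
    fun ψ v b => forcedSplits_restrict_satisfiable ψ v b
  have hunit : ∀ (ψ : CNF ℕ) (v : ℕ) (b : Bool), [(v, b)] ∈ ψ → ([] : Clause ℕ) ∈ restrict ψ v (!b) :=
    fun ψ v b h => forcedSplits_restrict_unit ψ v b h
  -- pointwise: on the support, an unsatisfiable accepted root with no violation is clean
  have hpt : ∀ ω : CNF ℕ × Equiv.Perm (Fin n) × (Fin n → Bool), (∀ c ∈ ω.1, ∀ l ∈ c, l.1 < n) →
      ¬ ω.1.Satisfiable → g ω.1 = true → nviol n g ω = 0 → clean n g ω := by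
    rintro ⟨φ, π, β⟩ hφ hunsat hroot hnv
    obtain ⟨ha1, ha2, hb, -, -, -, -⟩ := forcedSplits_run_invariant n (step n π β) restrict φ hφ (hstep π β) hR n _ rfl
    have hnil := forcedSplits_nil_mem_final n (step n π β) restrict φ hφ hunsat (hstep π β) hR (hhalt π β) hsat
    have hnov : ∀ r ∈ ((step n π β)^[n] (φ, [])).2, g r.1 = (g (restrict r.1 r.2.1 false) || g (restrict r.1 r.2.1 true)) := by
      intro r hr
      have h := (List.countP_eq_zero.1 hnv) r hr
      simpa using h
    exact forcedSplits_clean_of_noViolation restrict φ g _ ha1 ha2 hb hg0 hroot hnil hunit hnov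
  -- the support of the flow
  have hsupp : ∀ ω : CNF ℕ × Equiv.Perm (Fin n) × (Fin n → Bool), J n ω ≠ 0 → ∀ c ∈ ω.1, ∀ l ∈ c, l.1 < n := by
    intro ω hω
    rw [← PMF.mem_support_iff] at hω
    change ω ∈ ((randomKCNF 3 n (6 * n)).bind fun φ => (PMF.uniformOfFintype (Equiv.Perm (Fin n) × (Fin n → Bool))).map fun r => (φ, r)).support at hω
    rw [PMF.mem_support_bind_iff] at hω
    obtain ⟨φ, hφ, hω⟩ := hω
    rw [PMF.support_map] at hω
    obtain ⟨r, -, rfl⟩ := hω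
    exact fun c hc => LinGen.fst_lt_of_mem_kClauses (forall_mem_of_mem_support_randomKCNF hφ c hc)
  -- sum it up
  rw [PMF.toOuterMeasure_apply]
  refine ENNReal.tsum_le_tsum fun ω => ?_
  by_cases hω : ω ∈ {ω : CNF ℕ × Equiv.Perm (Fin n) × (Fin n → Bool) | ¬ ω.1.Satisfiable ∧ g ω.1 = true ∧ ¬ clean n g ω}
  · rw [Set.indicator_of_mem hω]
    by_cases hJ : J n ω = 0
    · rw [hJ]; exact bot_le
    · obtain ⟨hunsat, hroot, hnc⟩ := hω
      have hnv : nviol n g ω ≠ 0 := fun h => hnc (hpt ω (hsupp ω hJ) hunsat hroot h)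
      have h1 : (1 : ENNReal) ≤ (nviol n g ω : ENNReal) := by exact_mod_cast Nat.one_le_iff_ne_zero.2 hnv
      calc J n ω = J n ω * 1 := (mul_one _).symm
        _ ≤ J n ω * (nviol n g ω : ENNReal) := mul_le_mul' le_rfl h1
  · rw [Set.indicator_of_notMem hω]
    exact bot_le

end Summit.PneNP.PneNP.Theorems
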